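import Mathlib.RepresentationTheory.Basic
import Mathlib.RingTheory.WittVector.Basic
import Mathlib.NumberTheory.Padics.PadicVal.Basic
import Summits.BirchSwinnertonDyer.BirchSwinnertonDyer.Theses.BiquadraticEisensteinDescent

/-!
# Sketch (crux-ideate seat 2, g21) — first lemmas for the g21 crux-idea cards on
`HeegnerTwistCouplingInSupply` (stmt-BirchSwinnertonDyer-21381). Scratch only; BSD is not proved by this.

* `CoinvariantTraceDescent.normZero_iff_mem_augmentation` — card `coinvariant-trace-descent`:
  Maschke-level statement that for `p ∤ #G` the norm `N_G = Σ g` kills exactly the augmentation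
  submodule of an `𝔽_p[G]`-module (so `Tr_{H_K/K} P_K ∈ p·W(K)` iff `P_K` is an augmentation
  coboundary mod `p` — the one place where the supply hypothesis `p ∤ h_K` is consumed).
* `SaturationLevelDigit.wittAdd_coeff_one` — card `saturation-level-digit`: the degree-one Witt carry,
  i.e. the correction term when the Heegner trace is read at the second `p`-adic digit
  (`(x+y)₁ = x₁ + y₁ − Σ_{0<i<p} (C(p,i)/p) x₀^i y₀^{p-i}` in characteristic `p`).
* `SaturationLevelDigit.digit_of_multiple` — the elementary fact behind the Case-B wall: in a
  `ℤ_p`-line every multiple `I • g` of an element of valuation `≥ 1` has first digit `0`, whatever `I` is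
  (stated over `ZMod (p^2)`).
-/

namespace Summit.BirchSwinnertonDyer.BirchSwinnertonDyer.Cruxes.HeegnerTwistCouplingInSupply

namespace CoinvariantTraceDescent

/-- First lemma of card `coinvariant-trace-descent` (Maschke / norm–augmentation): for a finite group
`G` of order prime to `p` acting `𝔽_p`-linearly on `V`, the norm `Σ_g ρ g v` vanishes iff `v` lies in the
augmentation submodule spanned by the `ρ g u − u`. Applied to `V = W(H_K) ⊗ 𝔽_p`, `G = Cl(K)`,
`v = P_K`: `y_K = Tr P_K ∈ p W(K)` iff `P_K` is an augmentation coboundary mod `p`. -/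
def NormZeroIffMemAugmentation : Prop :=
  ∀ (p : ℕ) [Fact p.Prime] (G : Type) [Group G] [Fintype G] (V : Type) [AddCommGroup V]
    [Module (ZMod p) V] (ρ : Representation (ZMod p) G V), ¬ p ∣ Fintype.card G →
    ∀ v : V, (∑ g : G, ρ g v = 0 ↔
      v ∈ Submodule.span (ZMod p) {w : V | ∃ (g : G) (u : V), w = ρ g u - u})

end CoinvariantTraceDescent

namespace SaturationLevelDigit

/-- First lemma of card `saturation-level-digit` (degree-one Witt carry): in characteristic `p` the second
Witt coordinate of a sum is additive up to the carry polynomial in the first coordinates. This is the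
correction term in «digit₁(Σ_σ Φ(x̂_σ)) = Σ_σ G₁(x̃_σ) + carry(G₀(x̃_σ))». -/
def WittAddCoeffOne : Prop :=
  ∀ (p : ℕ) [hp : Fact p.Prime] (R : Type) [CommRing R] [CharP R p] (x y : WittVector p R),
    (x + y).coeff 1 = x.coeff 1 + y.coeff 1
      - ∑ i ∈ Finset.Ioo 0 p, ((p.choose i / p : ℕ) : R) * x.coeff 0 ^ i * y.coeff 0 ^ (p - i)

/-- The Case-B wall in one line: in `ℤ/p²` (a length-two truncation of the `ℤ_p`-line `W₀(ℚ_p)`), every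
integer multiple of an element divisible by `p` is divisible by `p` — so if the generator's image `g` has
first digit `0`, so does `I • g` for every Heegner index `I`; the first informative digit is the second. -/
theorem digit_of_multiple (p : ℕ) (g : ZMod (p ^ 2)) (hg : (p : ZMod (p ^ 2)) ∣ g) (I : ℤ) :
    (p : ZMod (p ^ 2)) ∣ I • g := by
  obtain ⟨c, rfl⟩ := hg
  exact ⟨I • c, by rw [zsmul_eq_mul, zsmul_eq_mul]; ring⟩

end SaturationLevelDigit

end Summit.BirchSwinnertonDyer.BirchSwinnertonDyer.Cruxes.HeegnerTwistCouplingInSupply
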